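/-
Copyright (c) 2026. All rights reserved.
Released under Apache 2.0 license as described in the file LICENSE.
-/
import Summits.HodgeConjecture.HodgeConjecture.Theorems.K2LiuArchHeightOfFrame   -- ★ FILE 14 (D-C′): `norm_det_toBlocks₁₁_mul_norm_det_denom`, `norm_detDeltaM_archAt_eq`, frame letters & Shimura shape
import HarnessLib

/-!
# Crux `HLiu418`, G6-arch ASSEMBLY FILE 16 — (E8rec) DICTIONARY, bricks (D-A)′ + (D-C)′: THE IWASAWA DECOMPOSITION OF `H_∞` RELATIVE TO THE FRAME COMPACT
# `K_fr := {k | Fr k w ∈ Stab(i1) ∀ w}` (tube Iwasawa ★ `U(J) = P_Δ·Stab(i1)` pulled back through the frames), the DATUM-FREE height identity, and the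
# CONJUGATED height `H_𝒦(a) · ∏_w ‖j(Fr(a·g) w, i1)‖ = H_𝒦(g⁻¹)` for every datum whose arch compact is `g·K_fr·g⁻¹`

Cell `hodgecm-mathlib`, crux item hLiu418 = `stmt-HodgeConjecture-24832` (helper lane `--supports`, count-neutral).  K2Liu-p11 (g4), (E8rec) dictionary (census
22:28Z, presentation head 22:37Z); consumer: `exists_flat_tube_presentation` ⇒ K2Liu-p13 (g4)'s `hArch`.

WHY.  (E6′)'s arch factor is flat for the height `H_𝒦(a) = modDelta (𝒦.pPart (a,1))` of a STANDARD datum `𝒦`, whose archimedean compact `C_∞` is a maximal compact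
of `H_∞` CONJUGATE to the frame compact `K_fr = ∏_w Fr_w⁻¹(Stab(i1))` (★ B2 `K2LiuStdArchCompactConjugate.exists_conj_archCompact` + the frame reading of the sign-block
compact): `C_∞ = g·K_fr·g⁻¹`.  The tube compact pictures of ★ FILE 9 ∕ ★ (E8) END are `Stab(i1)`-flat.  This file supplies the two halves of the reconciliation that do NOT
depend on how `g` is produced (the conjugator enters BY VALUE through `hg : (∀ w, Fr k w ∈ Stab(i1)) → (g k g⁻¹, 1) ∈ 𝒦.K`):
* §1 (per place) **`exists_siegel_mul_stab_archLocal`** — every `g ∈ U(J^𝔻)(L_w)` is `p·k` with `Fr p` tube-Siegel and `Fr k ∈ Stab(i1)` (★ `exists_transl_levi_mul_stabilizer`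
  through clause (vi) and frame injectivity); `frame_conj_mul` (the GL-level frame is multiplicative).
* §2 (global) **`exists_siegel_mul_frameStab`** — every `a ∈ H_∞` is `p·k` with `(p,1) ∈ P_Δ(𝔸)` (★ `isSiegelDelta_archPiEquivCM_symm_iff` + ★ F0P2-p08
  `isSiegelM_and_toBlocks₁₁_mul_of_tube`) and `Fr k w ∈ Stab(i1)` at every complex place (glued by ★ `archPiEquivCM`).
* §3 **`modDelta_archToAdelic_mul_prod_norm_det_denom_eq_one`** — DATUM-FREE height identity `modDelta (p,1) · ∏_w ‖j(Fr (p·k) w, i1)‖ = 1` (★ FILE 14 §1–§2 letters);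
  **`heightArch_mul_prod_eq_heightArch_inv`** — for an Iwasawa datum `𝒦` and `g ∈ H_∞` with `hg`: `H_𝒦(a) · ∏_w ‖j(Fr (a·g) w, i1)‖ = H_𝒦(g⁻¹)` for EVERY `a ∈ H_∞`
  (`a·g = p·k₀` by §2; `a = (p·g⁻¹)·(g k₀ g⁻¹)`; ★ `IwasawaDatum.modDelta_pPart_mul_K`, ★ `IwasawaDatum.modDelta_pPart_delta_mul`; §3) — so (E6′)'s flat factor is
  `H_𝒦(g⁻¹)^{2(s−s₀)} · (∏_w ‖j(Fr(a·g) w, i1)‖)^{−2(s−s₀)} · A(a)`, the shape ★ FILE 13 `prod_flatTwist` turns into a place-pure product of flat tube sections at `a·g`.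
References: [Shimura1997, §§5–6, §6.4, §16.4]; [BorelJacquet1979, §4.1]; [Tan1999, §1]; [Weil1964, Chap. I n° 8].
HONEST LABEL: HC_CM is proved only modulo the 7 printed citations (2 remaining named inputs: hLiu418 = stmt-HodgeConjecture-24832,
h413 = stmt-HodgeConjecture-24833) until rung 0 closes; count-neutral helper, closes no socket.
-/

set_option autoImplicit false
set_option linter.dupNamespace false

noncomputable section

open scoped Matrix ComplexConjugate
open Complex Matrix NumberField NumberField.InfinitePlace
open Literature.NumberTheory.ModularForms.SiegelUpperHalfSpace (denom moeb)
open Literature.NumberTheory.Automorphic Literature.NumberTheory.Automorphic.UnitaryGroup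
open Literature.NumberTheory.GelbartRogawski1991 Literature.NumberTheory.GelbartRogawski1991.GRConstruction
open Literature.NumberTheory.GelbartRogawski1991.UnitaryDualPair
open Literature.NumberTheory.K2Lit.SiegelDoubled

namespace Summit.HodgeConjecture.HodgeConjecture.Cruxes.HLiu418.K2LiuArchStabIwasawaOfFrame

open K2LiuHermitianTubeCocycle K2LiuHermitianTubeAction K2LiuArchInducedTubeSectionPrelims K2LiuHolTubeRigidityOfFrame K2LiuArchSiegelCharacterTube
  K2LiuIwasawaDeltaUnimodular K2LiuArchHeightOfFrame
open K2LiuArchSliceSiegel (isSiegelDelta_archPiEquivCM_symm_iff)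

variable (L : Type) [Field L] [NumberField L] [IsCMField L] {N M n : ℕ} (e : Fin N × Fin M ≃ Fin n)
  (dV : Fin N → L) (hdV : ∀ i, IsCMField.complexConj L (dV i) = dV i) (hdV0 : ∀ i, dV i ≠ 0)
  (dW : Fin M → L) (hdW : ∀ i, IsCMField.complexConj L (dW i) = dW i) (hdW0 : ∀ i, dW i ≠ 0)
  (T Tinv : {w : InfinitePlace L // w.IsComplex} → Matrix (Fin n ⊕ Fin n) (Fin n ⊕ Fin n) ℂ)
  (Fr : UnitaryGroup.arch (Fp L) L (IsCMField.complexConj L) (n + n) (hermD L e dV hdV dW hdW) →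
    {w : InfinitePlace L // w.IsComplex} → Matrix (Fin n ⊕ Fin n) (Fin n ⊕ Fin n) ℂ)
  (hFr : ∀ a w, Fr a w = T w * Matrix.reindex (e₂ (n := n)).symm (e₂ (n := n)).symm
    (((UnitaryGroup.archAt (Fp L) L (IsCMField.complexConj L) (n + n) (hermD L e dV hdV dW hdW) w
      (UnitaryGroup.complexConj_smul_infinitePlace L w.1) (IsCMField.complexConj_ne_one L) a :
        UnitaryGroup.archLocal L (n + n) (hermD L e dV hdV dW hdW) w) : GL (Fin (n + n)) ℂ) : Matrix (Fin (n + n)) (Fin (n + n)) ℂ) * Tinv w)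
  (hT2 : ∀ w, Tinv w * T w = 1)
  (hTU : ∀ w (g : GL (Fin (n + n)) ℂ), g ∈ UnitaryGroup.archLocal L (n + n) (hermD L e dV hdV dW hdW) w →
    (T w * Matrix.reindex (e₂ (n := n)).symm (e₂ (n := n)).symm (g : Matrix _ _ ℂ) * Tinv w)ᴴ * Matrix.J (Fin n) ℂ *
      (T w * Matrix.reindex (e₂ (n := n)).symm (e₂ (n := n)).symm (g : Matrix _ _ ℂ) * Tinv w) = Matrix.J (Fin n) ℂ)
  (hTS : ∀ w (g : GL (Fin (n + n)) ℂ), IsSiegelM (n := n) (g : Matrix (Fin (n + n)) (Fin (n + n)) ℂ) →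
    (T w * Matrix.reindex (e₂ (n := n)).symm (e₂ (n := n)).symm (g : Matrix _ _ ℂ) * Tinv w).toBlocks₂₁ = 0)
  (hTV : ∀ w (P : Matrix (Fin n ⊕ Fin n) (Fin n ⊕ Fin n) ℂ), Pᴴ * Matrix.J (Fin n) ℂ * P = Matrix.J (Fin n) ℂ →
    ∃ g : GL (Fin (n + n)) ℂ, g ∈ UnitaryGroup.archLocal L (n + n) (hermD L e dV hdV dW hdW) w ∧
      T w * Matrix.reindex (e₂ (n := n)).symm (e₂ (n := n)).symm (g : Matrix _ _ ℂ) * Tinv w = P)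
  (D C : {w : InfinitePlace L // w.IsComplex} → Matrix (Fin n) (Fin n) ℂ)
  (hTsh : ∀ w, T w = fromBlocks (D w) (D w) (C w) (-(C w))) (hD : ∀ w, IsUnit (D w).det) (hC : ∀ w, IsUnit (C w).det)

/-! ## §1  One place: `g = p · k` with `Fr p` tube-Siegel and `Fr k ∈ Stab(i1)` -/

omit [NumberField L] in
include hT2 in
/-- **the GL-level frame is multiplicative**: `T·(p k)~·T⁻¹ = (T·p̃·T⁻¹)·(T·k̃·T⁻¹)`. [Shimura1997, §6] -/
theorem frame_conj_mul (w : {w : InfinitePlace L // w.IsComplex}) (p k : GL (Fin (n + n)) ℂ) :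
    T w * Matrix.reindex (e₂ (n := n)).symm (e₂ (n := n)).symm ((p * k : GL (Fin (n + n)) ℂ) : Matrix (Fin (n + n)) (Fin (n + n)) ℂ) * Tinv w =
      T w * Matrix.reindex (e₂ (n := n)).symm (e₂ (n := n)).symm (p : Matrix (Fin (n + n)) (Fin (n + n)) ℂ) * Tinv w *
        (T w * Matrix.reindex (e₂ (n := n)).symm (e₂ (n := n)).symm (k : Matrix (Fin (n + n)) (Fin (n + n)) ℂ) * Tinv w) := by
  have hre : Matrix.reindex (e₂ (n := n)).symm (e₂ (n := n)).symm ((p : Matrix (Fin (n + n)) (Fin (n + n)) ℂ) * (k : Matrix (Fin (n + n)) (Fin (n + n)) ℂ)) =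
      Matrix.reindex (e₂ (n := n)).symm (e₂ (n := n)).symm (p : Matrix (Fin (n + n)) (Fin (n + n)) ℂ) *
        Matrix.reindex (e₂ (n := n)).symm (e₂ (n := n)).symm (k : Matrix (Fin (n + n)) (Fin (n + n)) ℂ) := by
    rw [Matrix.reindex_apply, Matrix.reindex_apply, Matrix.reindex_apply]
    exact (Matrix.submatrix_mul_equiv (p : Matrix (Fin (n + n)) (Fin (n + n)) ℂ) (k : Matrix (Fin (n + n)) (Fin (n + n)) ℂ) _ (e₂ (n := n)).symm.symm _).symm
  rw [Units.val_mul, hre, show T w * Matrix.reindex (e₂ (n := n)).symm (e₂ (n := n)).symm (p : Matrix (Fin (n + n)) (Fin (n + n)) ℂ) * Tinv w *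
      (T w * Matrix.reindex (e₂ (n := n)).symm (e₂ (n := n)).symm (k : Matrix (Fin (n + n)) (Fin (n + n)) ℂ) * Tinv w) =
    T w * Matrix.reindex (e₂ (n := n)).symm (e₂ (n := n)).symm (p : Matrix (Fin (n + n)) (Fin (n + n)) ℂ) * (Tinv w * T w) *
      Matrix.reindex (e₂ (n := n)).symm (e₂ (n := n)).symm (k : Matrix (Fin (n + n)) (Fin (n + n)) ℂ) * Tinv w by simp only [Matrix.mul_assoc],
    hT2, Matrix.mul_one]
  simp only [Matrix.mul_assoc]

include hT2 hTU hTV in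
/-- **ONE PLACE: `U(J^𝔻)(L_w) = P_w · K_fr,w`** — every `g` of the local archimedean group factors as `g = p·k` with `Fr p` TUBE-SIEGEL (`(T p̃ T⁻¹)₂₁ = 0`) and `Fr k` in the
stabiliser of `i·1` (★ tube Iwasawa `exists_transl_levi_mul_stabilizer` + clause (vi) + frame injectivity). [Shimura1997, §6.4] [BorelJacquet1979, §4.1] -/
theorem exists_siegel_mul_stab_archLocal (w : {w : InfinitePlace L // w.IsComplex}) {g : GL (Fin (n + n)) ℂ}
    (hg : g ∈ UnitaryGroup.archLocal L (n + n) (hermD L e dV hdV dW hdW) w) :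
    ∃ p k : GL (Fin (n + n)) ℂ, p ∈ UnitaryGroup.archLocal L (n + n) (hermD L e dV hdV dW hdW) w ∧ k ∈ UnitaryGroup.archLocal L (n + n) (hermD L e dV hdV dW hdW) w ∧
      (T w * Matrix.reindex (e₂ (n := n)).symm (e₂ (n := n)).symm (p : Matrix (Fin (n + n)) (Fin (n + n)) ℂ) * Tinv w).toBlocks₂₁ = 0 ∧
      moeb (T w * Matrix.reindex (e₂ (n := n)).symm (e₂ (n := n)).symm (k : Matrix (Fin (n + n)) (Fin (n + n)) ℂ) * Tinv w) (I • (1 : Matrix (Fin n) (Fin n) ℂ)) = I • 1 ∧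
      g = p * k := by
  obtain ⟨X, R, u, hX, hR, hRu, hu, huI, hdec⟩ := exists_transl_levi_mul_stabilizer (hTU w g hg)
  obtain ⟨p, hp, hTp⟩ := hTV w _ (transl_mul_levi_mem hX hR hRu)
  obtain ⟨k, hk, hTk⟩ := hTV w u hu
  refine ⟨p, k, hp, hk, by rw [hTp]; exact toBlocks₂₁_transl_mul_levi X R, by rw [hTk]; exact huI, ?_⟩
  have key : T w * Matrix.reindex (e₂ (n := n)).symm (e₂ (n := n)).symm (g : Matrix (Fin (n + n)) (Fin (n + n)) ℂ) * Tinv w =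
      T w * Matrix.reindex (e₂ (n := n)).symm (e₂ (n := n)).symm ((p * k : GL (Fin (n + n)) ℂ) : Matrix (Fin (n + n)) (Fin (n + n)) ℂ) * Tinv w := by
    rw [frame_conj_mul L T Tinv hT2 w p k, hTp, hTk, ← hdec]
  exact Units.ext ((Matrix.reindex (e₂ (n := n)).symm (e₂ (n := n)).symm).injective (eq_of_frame_conj_eq L T Tinv (hT2 w) key))

/-! ## §2  Global: `H_∞ = P_∞ · K_fr` -/

include hFr hT2 hTU hTV hTsh hC in
/-- **`H_∞ = P_Δ(L⁺ ⊗ ℝ) · K_fr`**: every `a ∈ H_∞` factors as `a = p·k` with `(p, 1) ∈ P_Δ(𝔸)` and `Fr k w ∈ Stab(i1)` at every complex place (§1 place by place, glued by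
★ `archPiEquivCM`; `P_Δ` by ★ `isSiegelDelta_archPiEquivCM_symm_iff` + ★ `isSiegelM_and_toBlocks₁₁_mul_of_tube`). [BorelJacquet1979, §4.1] [Shimura1997, §6.4] -/
theorem exists_siegel_mul_frameStab (a : UnitaryGroup.arch (Fp L) L (IsCMField.complexConj L) (n + n) (hermD L e dV hdV dW hdW)) :
    ∃ p k : UnitaryGroup.arch (Fp L) L (IsCMField.complexConj L) (n + n) (hermD L e dV hdV dW hdW),
      IsSiegelDelta L e dV hdV dW hdW (UnitaryGroup.archToAdelic (Fp L) L (IsCMField.complexConj L) (n + n) (hermD L e dV hdV dW hdW) p) ∧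
      (∀ w, moeb (Fr k w) (I • (1 : Matrix (Fin n) (Fin n) ℂ)) = I • 1) ∧ a = p * k := by
  choose p k hp hk hTp hTk hdec using fun w : {w : InfinitePlace L // w.IsComplex} =>
    exists_siegel_mul_stab_archLocal L e dV hdV dW hdW T Tinv hT2 hTU hTV w
      (UnitaryGroup.archAt (Fp L) L (IsCMField.complexConj L) (n + n) (hermD L e dV hdV dW hdW) w
        (UnitaryGroup.complexConj_smul_infinitePlace L w.1) (IsCMField.complexConj_ne_one L) a).2
  let Ψ := UnitaryGroup.archPiEquivCM (n + n) L (hermD L e dV hdV dW hdW)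
  refine ⟨Ψ.symm (fun w => ⟨p w, hp w⟩), Ψ.symm (fun w => ⟨k w, hk w⟩), ?_, fun w => ?_, ?_⟩
  · -- `(p, 1) ∈ P_Δ(𝔸)`: every place component is `IsSiegelM` (tube-Siegel ⇒ `IsSiegelM`)
    refine (isSiegelDelta_archPiEquivCM_symm_iff L e dV hdV dW hdW _).2 fun w => ?_
    have hinv : Tinv w * fromBlocks (D w) (D w) (C w) (-(C w)) = 1 := by rw [← hTsh]; exact hT2 w
    have hP : (fromBlocks (D w) (D w) (C w) (-(C w)) * Matrix.reindex (e₂ (n := n)).symm (e₂ (n := n)).symm (p w : Matrix (Fin (n + n)) (Fin (n + n)) ℂ) *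
        Tinv w).toBlocks₂₁ = 0 := by rw [← hTsh]; exact hTp w
    exact (isSiegelM_and_toBlocks₁₁_mul_of_tube (D w) (C w) (Tinv w) hinv (hC w) _ hP).1
  · -- `Fr k w ∈ Stab(i1)`
    rw [hFr]
    have h : UnitaryGroup.archAt (Fp L) L (IsCMField.complexConj L) (n + n) (hermD L e dV hdV dW hdW) w
        (UnitaryGroup.complexConj_smul_infinitePlace L w.1) (IsCMField.complexConj_ne_one L) (Ψ.symm fun w => ⟨k w, hk w⟩) =
        Ψ (Ψ.symm fun w => ⟨k w, hk w⟩) w := rfl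
    rw [h, ContinuousMulEquiv.apply_symm_apply]
    exact hTk w
  · -- `a = p · k`
    apply Ψ.injective
    rw [map_mul, ContinuousMulEquiv.apply_symm_apply, ContinuousMulEquiv.apply_symm_apply]
    funext w
    apply Subtype.ext
    exact hdec w

/-! ## §3  The datum-free height identity and the conjugated height -/

include hFr hT2 hTU hTS hTsh hD hC in
/-- **DATUM-FREE HEIGHT IDENTITY**: `modDelta (p, 1) · ∏_w ‖j(Fr (p·k) w, i1)‖ = 1` for `(p,1) ∈ P_Δ(𝔸)` and `Fr k w ∈ Stab(i1)` at every place (★ `modDelta_archToAdelic_eq_prod`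
re-indexed over the complex places, ★ FILE 14 `norm_detDeltaM_archAt_eq` + `norm_det_toBlocks₁₁_mul_norm_det_denom` place by place). [Kudla1994, §3] [Shimura1997, §16.4] -/
theorem modDelta_archToAdelic_mul_prod_norm_det_denom_eq_one [Fintype {w : InfinitePlace L // w.IsComplex}]
    {p k : UnitaryGroup.arch (Fp L) L (IsCMField.complexConj L) (n + n) (hermD L e dV hdV dW hdW)}
    (hp : IsSiegelDelta L e dV hdV dW hdW (UnitaryGroup.archToAdelic (Fp L) L (IsCMField.complexConj L) (n + n) (hermD L e dV hdV dW hdW) p))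
    (hkS : ∀ w, moeb (Fr k w) (I • (1 : Matrix (Fin n) (Fin n) ℂ)) = I • 1) :
    modDelta L e dV hdV dW hdW (UnitaryGroup.archToAdelic (Fp L) L (IsCMField.complexConj L) (n + n) (hermD L e dV hdV dW hdW) p) *
      ∏ w : {w : InfinitePlace L // w.IsComplex}, ‖(denom (Fr (p * k) w) (I • (1 : Matrix (Fin n) (Fin n) ℂ))).det‖ = 1 := by
  rw [modDelta_archToAdelic_eq_prod L e dV hdV dW hdW p hp]
  have hre : (∏ w' : InfinitePlace L, ‖detDeltaM (n := n) (((UnitaryGroup.archAt (Fp L) L (IsCMField.complexConj L) (n + n) (hermD L e dV hdV dW hdW)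
        ⟨w', isComplex_infinitePlace L w'⟩ (UnitaryGroup.complexConj_smul_infinitePlace L w') (IsCMField.complexConj_ne_one L) p :
          UnitaryGroup.archLocal L (n + n) (hermD L e dV hdV dW hdW) ⟨w', isComplex_infinitePlace L w'⟩) : GL (Fin (n + n)) ℂ) : Matrix (Fin (n + n)) (Fin (n + n)) ℂ)‖) =
      ∏ w : {w : InfinitePlace L // w.IsComplex}, ‖detDeltaM (n := n) (((UnitaryGroup.archAt (Fp L) L (IsCMField.complexConj L) (n + n) (hermD L e dV hdV dW hdW) w
        (UnitaryGroup.complexConj_smul_infinitePlace L w.1) (IsCMField.complexConj_ne_one L) p :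
          UnitaryGroup.archLocal L (n + n) (hermD L e dV hdV dW hdW) w) : GL (Fin (n + n)) ℂ) : Matrix (Fin (n + n)) (Fin (n + n)) ℂ)‖ :=
    Fintype.prod_equiv (Equiv.subtypeUnivEquiv (fun w : InfinitePlace L => isComplex_infinitePlace L w)).symm _ _ (fun _ => rfl)
  rw [hre, ← Finset.prod_mul_distrib]
  refine Finset.prod_eq_one fun w _ => ?_
  rw [norm_detDeltaM_archAt_eq L e dV hdV dW hdW T Tinv Fr hFr hT2 hTS D C hTsh hD hC hp w, frame_mul L e dV hdV dW hdW T Tinv Fr hFr hT2]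
  exact norm_det_toBlocks₁₁_mul_norm_det_denom (frame_mem L e dV hdV dW hdW T Tinv Fr hFr hTU p w)
    (frame_toBlocks₂₁_eq_zero L e dV hdV dW hdW T Tinv Fr hFr hTS hp w) (frame_mem L e dV hdV dW hdW T Tinv Fr hFr hTU k w) (hkS w)

include hFr hT2 hTU hTS hTV hTsh hD hC hdV0 hdW0 in
/-- **THE CONJUGATED HEIGHT** (the arch twin of the finite-place reflattening).  For an Iwasawa datum `𝒦` and `g ∈ H_∞` such that `(g k g⁻¹, 1) ∈ 𝒦.K` whenever `k` frames
into `Stab(i1)` at every place (the standard datum's arch compact is `g·K_fr·g⁻¹`, ★ B2): for EVERY `a ∈ H_∞`,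
`modDelta (𝒦.pPart (a,1)) · ∏_w ‖j(Fr (a·g) w, i1)‖ = modDelta (𝒦.pPart (g⁻¹,1))` — (E6′)'s height IS the product of the tube heights at the TRANSLATED point `a·g`, up to the
constant `H_𝒦(g⁻¹)` (`a·g = p·k₀` by §2, `a = (p·g⁻¹)·(g k₀ g⁻¹)`, ★ `IwasawaDatum.modDelta_pPart_mul_K` ∕ `_delta_mul`, §3). [Tan1999, §1] [Weil1964, Chap. I n° 8]
[BorelJacquet1979, §4.1] [Shimura1997, §16.4] -/
theorem heightArch_mul_prod_eq_heightArch_inv [Fintype {w : InfinitePlace L // w.IsComplex}] (𝒦 : IwasawaDatum L e dV hdV dW hdW)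
    (g : UnitaryGroup.arch (Fp L) L (IsCMField.complexConj L) (n + n) (hermD L e dV hdV dW hdW))
    (hg : ∀ k : UnitaryGroup.arch (Fp L) L (IsCMField.complexConj L) (n + n) (hermD L e dV hdV dW hdW),
      (∀ w, moeb (Fr k w) (I • (1 : Matrix (Fin n) (Fin n) ℂ)) = I • 1) →
        (UnitaryGroup.archToAdelic (Fp L) L (IsCMField.complexConj L) (n + n) (hermD L e dV hdV dW hdW) (g * k * g⁻¹) : HA L e dV hdV dW hdW) ∈ 𝒦.K)
    (a : UnitaryGroup.arch (Fp L) L (IsCMField.complexConj L) (n + n) (hermD L e dV hdV dW hdW)) :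
    modDelta L e dV hdV dW hdW (𝒦.pPart (UnitaryGroup.archToAdelic (Fp L) L (IsCMField.complexConj L) (n + n) (hermD L e dV hdV dW hdW) a)) *
        ∏ w : {w : InfinitePlace L // w.IsComplex}, ‖(denom (Fr (a * g) w) (I • (1 : Matrix (Fin n) (Fin n) ℂ))).det‖ =
      modDelta L e dV hdV dW hdW (𝒦.pPart (UnitaryGroup.archToAdelic (Fp L) L (IsCMField.complexConj L) (n + n) (hermD L e dV hdV dW hdW) g⁻¹)) := by
  have hK := IwasawaDatum.modDelta_eq_one_of_mem L e dV hdV hdV0 dW hdW hdW0 𝒦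
  obtain ⟨p, k₀, hp, hk₀, hdec⟩ := exists_siegel_mul_frameStab L e dV hdV dW hdW T Tinv Fr hFr hT2 hTU hTV D C hTsh hC (a * g)
  have ha : a = p * g⁻¹ * (g * k₀ * g⁻¹) := by
    rw [show p * g⁻¹ * (g * k₀ * g⁻¹) = p * k₀ * g⁻¹ by group, ← hdec, mul_inv_cancel_right]
  -- `H(a) = H(p·g⁻¹) = modDelta (p,1) · H(g⁻¹)`
  have h1a : modDelta L e dV hdV dW hdW (𝒦.pPart (UnitaryGroup.archToAdelic (Fp L) L (IsCMField.complexConj L) (n + n) (hermD L e dV hdV dW hdW) a)) =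
      modDelta L e dV hdV dW hdW (𝒦.pPart (UnitaryGroup.archToAdelic (Fp L) L (IsCMField.complexConj L) (n + n) (hermD L e dV hdV dW hdW) (p * g⁻¹))) := by
    rw [ha, map_mul]
    exact IwasawaDatum.modDelta_pPart_mul_K hK _ (hg k₀ hk₀)
  have h1 : modDelta L e dV hdV dW hdW (𝒦.pPart (UnitaryGroup.archToAdelic (Fp L) L (IsCMField.complexConj L) (n + n) (hermD L e dV hdV dW hdW) a)) =
      modDelta L e dV hdV dW hdW (UnitaryGroup.archToAdelic (Fp L) L (IsCMField.complexConj L) (n + n) (hermD L e dV hdV dW hdW) p) *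
        modDelta L e dV hdV dW hdW (𝒦.pPart (UnitaryGroup.archToAdelic (Fp L) L (IsCMField.complexConj L) (n + n) (hermD L e dV hdV dW hdW) g⁻¹)) := by
    rw [h1a, map_mul]
    exact IwasawaDatum.modDelta_pPart_delta_mul hK hp _
  rw [h1, hdec, mul_right_comm, modDelta_archToAdelic_mul_prod_norm_det_denom_eq_one L e dV hdV dW hdW T Tinv Fr hFr hT2 hTU hTS D C hTsh hD hC hp hk₀, one_mul]

end Summit.HodgeConjecture.HodgeConjecture.Cruxes.HLiu418.K2LiuArchStabIwasawaOfFrame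

end
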